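import Summits.QuantumFields.BalabanUV.Beta.GAN24.DerivativeRateTransferJensenMassFreePolarFactor

/-!
# `BalabanUV.Beta.GAN24.DerivativeRateTransferJensenMassFreePolarCommute` — binder row G-an2-4 ∕ (CONV-C), route R6 «VALUES, NOT DERIVATIVES», PART 65:
# THE POLAR LINKS STAY IN THE COMMUTANT — the orthogonal polar factor of PART 58 commutes with every orthogonal matrix that commutes with the mean
# transport; so if the fine transporters, the block transporters and the chains all commute with a complex structure `J` (realified `U(N)` data),
# the polar coarse links are `J`-linear, i.e. UNITARY in the realified picture — PART 58's scope note «`R′` in the full orthogonal group» sharpened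
# for the unitary groups (unit b2b-balaban-gan24-p3, gen 44; v1)

NOT IN PRINT; OUR PROOF (for the ROUTE; [folklore] — PART 58's construction `R′ = M·(MᵀM)^{−1∕2}` with Mathlib's `Commute.cfc_nnreal` (the functional
calculus preserves commutants) and `CFC.sqrt_eq_cfc`).  HONEST FRAMING (cell contract, verbatim): «discharging `BetaPertH` makes Bałaban's UV stability
UNCONDITIONAL — a real constructive-QFT result; it is NOT the continuum limit and NOT the Clay problem.»  HONEST DEPENDENCY (verbatim): «continuum YM on T⁴
⇐ BetaPertH ∧ nine spine estimates (0/9 proved); BetaPertH ⇐ (D1) ∧ (D4) ∧ CAP+tail; G-an2-4 gates asym, D1 and NE2/3/4.»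

WHY THIS FILE.  PART 58 produces the polar coarse link `R′` in the full orthogonal group `O(o)` of the (real) colour fibre and does not assert that it lies
in the image of the structure group.  For the unitary groups the realified picture is: `o = ℝ^{2N}` with a complex structure `J` (`JᵀJ = 1`, `Jᵀ = −J`),
and `U(N) = O(2N) ∩ {J-linear}`.  (§1) **`exists_orthogonal_polar_commute`**: PART 58's polar factor can be taken to commute with EVERY orthogonal `J`
commuting with `M` (`Mᵀ` commutes with `J` too, hence `S = MᵀM`, hence `S^{1∕2} = cfc √· S` by `Commute.cfc_nnreal`, hence its inverse, hence
`R′ = M·S^{−1∕2}`); (§2) `commute_transpose_of_orthogonal`, `commute_wsum`, **`exists_polarLink_commute`**: in PART 47 ∕ 57's letters, if the block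
transporters `W`, the chain transports `T(·,·,ℓ)` and hence the open transports commute with an orthogonal `J`, there are polar links with PART 53 ∕ 57's
three letters AND `R′_{e′}J = JR′_{e′}` — for a complex structure `J`: U(N)-valued data give U(N)-valued polar links.

HONEST SCOPE.  `SU(N)`, `N ≥ 3` is NOT addressed (the unitary polar factor of a mean of `SU(N)` elements carries a `U(1)` phase `det`; a determinant-one
convention is a further normalisation within `O(spread³)`, PART 56's transfer); `Ad SU(2) = SO(3)` needs no `J`.  Nothing of Bałaban's instantiated.

WHAT THIS FILE PROVES (0 sorry, 0 `def`, nothing cited): §1 `commute_transpose_of_orthogonal`, `commute_nonsing_inv_of_commute`, **`exists_orthogonal_polar_commute`**;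
§2 `commute_wsum`, **`exists_polarLink_commute`**.
SUPPLIER work on route R6 (rank 2, REDUCTION, no seat); no consumer of record; NEVER «G-an2-4 closed»; NOT (CONV-C), NOT D1, NOT `BetaPertH`, NOT
continuum, NOT Clay.  Records: `HOME/b2b-balaban-gan24-p3/WOODBURY-FIBRE.md` v14.4. -/

noncomputable section

open Matrix Finset
open scoped MatrixOrder

namespace Summit.QuantumFields.BalabanUV.Beta.GAN24.DerivativeRateTransferJensenMassFreePolarCommute

open Summit.QuantumFields.BalabanUV.Beta.GAN24.DerivativeRateTransferJensenChain
open Summit.QuantumFields.BalabanUV.Beta.GAN24.DerivativeRateTransferJensenMassFreePolarFactor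

/-! ## §1 The polar factor commutes with the orthogonal commutant of `M` -/

section Polar

variable {o : Type*} [Fintype o] [DecidableEq o]

/-- `J` orthogonal, `MJ = JM` ⟹ `MᵀJ = JMᵀ` (`Mᵀ` commutes with `Jᵀ = J⁻¹`, hence with `J`). [folklore] -/
theorem commute_transpose_of_orthogonal {M J : Matrix o o ℝ} (hJ : Jᵀ * J = 1) (h : Commute M J) : Commute Mᵀ J := by
  have hJJt : J * Jᵀ = 1 := mul_transpose_of_orthogonal hJ
  have ht : Mᵀ * Jᵀ = Jᵀ * Mᵀ := by
    rw [← transpose_mul, ← transpose_mul, h.eq]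
  -- `MᵀJ = (JJᵀ)MᵀJ = J(JᵀMᵀ)J = J(MᵀJᵀ)J = JMᵀ(JᵀJ) = JMᵀ`
  show Mᵀ * J = J * Mᵀ
  calc Mᵀ * J = (J * Jᵀ) * Mᵀ * J := by rw [hJJt, Matrix.one_mul]
    _ = J * (Jᵀ * Mᵀ) * J := by simp only [Matrix.mul_assoc]
    _ = J * (Mᵀ * Jᵀ) * J := by rw [ht]
    _ = J * Mᵀ * (Jᵀ * J) := by simp only [Matrix.mul_assoc]
    _ = J * Mᵀ := by rw [hJ, Matrix.mul_one]

/-- `P` invertible, `PJ = JP` ⟹ `P⁻¹J = JP⁻¹`. [folklore] -/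
theorem commute_nonsing_inv_of_commute {P J : Matrix o o ℝ} (hP : IsUnit P.det) (h : Commute P J) : Commute P⁻¹ J := by
  have h1 : P⁻¹ * P = 1 := Matrix.nonsing_inv_mul P hP
  have h2 : P * P⁻¹ = 1 := Matrix.mul_nonsing_inv P hP
  show P⁻¹ * J = J * P⁻¹
  calc P⁻¹ * J = P⁻¹ * J * (P * P⁻¹) := by rw [h2, Matrix.mul_one]
    _ = P⁻¹ * (J * P) * P⁻¹ := by simp only [Matrix.mul_assoc]
    _ = P⁻¹ * (P * J) * P⁻¹ := by rw [h.eq]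
    _ = (P⁻¹ * P) * J * P⁻¹ := by simp only [Matrix.mul_assoc]
    _ = J * P⁻¹ := by rw [h1, Matrix.one_mul]

/-- **`exists_orthogonal_polar_commute` — THE POLAR FACTOR STAYS IN THE COMMUTANT** [folklore; our proof]: a real square `M` with `M·` injective has an
orthogonal `R′` with `M·R′ᵀ` symmetric positive semidefinite (PART 58) which moreover COMMUTES with every ORTHOGONAL `J` commuting with `M`. -/
theorem exists_orthogonal_polar_commute {M : Matrix o o ℝ} (hM : Function.Injective M.mulVec) :
    ∃ R' : Matrix o o ℝ, R'ᵀ * R' = 1 ∧ (M * R'ᵀ)ᵀ = M * R'ᵀ ∧ (∀ w : o → ℝ, 0 ≤ w ⬝ᵥ ((M * R'ᵀ) *ᵥ w)) ∧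
      ∀ J : Matrix o o ℝ, Jᵀ * J = 1 → Commute M J → Commute R' J := by
  set S : Matrix o o ℝ := Mᵀ * M with hSdef
  have hS : S.PosDef := posDef_transpose_mul_self_of_injective hM
  set P : Matrix o o ℝ := CFC.sqrt S with hPdef
  have hPP : P * P = S := CFC.sqrt_mul_sqrt_self S hS.posSemidef.nonneg
  have hPpsd : P.PosSemidef := (CFC.sqrt_nonneg S).posSemidef
  have hPt : Pᵀ = P := transpose_eq_of_posSemidef hPpsd
  have hPunit : IsUnit P := by
    have h : IsUnit (P * P) := by rw [hPP]; exact hS.isUnit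
    exact isUnit_mul_self_iff.mp h
  have hPdet : IsUnit P.det := (Matrix.isUnit_iff_isUnit_det P).mp hPunit
  have hinvP : P⁻¹ * P = 1 := Matrix.nonsing_inv_mul P hPdet
  have hPinv : P * P⁻¹ = 1 := Matrix.mul_nonsing_inv P hPdet
  have hPit : (P⁻¹)ᵀ = P⁻¹ := by rw [transpose_nonsing_inv, hPt]
  have e : (M * P⁻¹)ᵀ = P⁻¹ * Mᵀ := by rw [transpose_mul, hPit]
  refine ⟨M * P⁻¹, ?_, ?_, ?_, ?_⟩
  · rw [e]
    calc P⁻¹ * Mᵀ * (M * P⁻¹) = P⁻¹ * (Mᵀ * M) * P⁻¹ := by simp only [Matrix.mul_assoc]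
      _ = P⁻¹ * (P * P) * P⁻¹ := by rw [← hSdef, hPP]
      _ = (P⁻¹ * P) * (P * P⁻¹) := by simp only [Matrix.mul_assoc]
      _ = 1 := by rw [hinvP, hPinv, Matrix.mul_one]
  · rw [e, ← Matrix.mul_assoc, transpose_mul, transpose_mul, transpose_transpose, hPit, Matrix.mul_assoc]
  · intro w
    rw [e, ← mulVec_mulVec, ← mulVec_mulVec, dotProduct_mulVec, ← mulVec_transpose]
    have h := hPpsd.inv.dotProduct_mulVec_nonneg (Mᵀ *ᵥ w)
    simpa only [star_trivial] using h
  · intro J hJ hMJ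
    have hMtJ : Commute Mᵀ J := commute_transpose_of_orthogonal hJ hMJ
    have hSJ : Commute S J := by rw [hSdef]; exact hMtJ.mul_left hMJ
    have hPJ : Commute P J := by
      rw [hPdef, CFC.sqrt_eq_cfc]
      exact hSJ.cfc_nnreal NNReal.sqrt
    exact hMJ.mul_left (commute_nonsing_inv_of_commute hPdet hPJ)

end Polar

/-! ## §2 In PART 47 ∕ 57's letters: polar links in the commutant -/

section Link

variable {o μ ν β' : Type*} [Fintype o] [DecidableEq o] [Fintype ν]
variable {q : μ → ν → ℝ} {W : μ → ν → Matrix o o ℝ} {src' tgt' : β' → μ}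
variable {σ : β' → ν ≃ ν} {ℓ : ℕ} {T : β' → ν → ℕ → Matrix o o ℝ} {D : ℝ}

omit [DecidableEq o] in
/-- a weighted sum of matrices commuting with `J` commutes with `J`. [folklore] -/
theorem commute_wsum (q : ν → ℝ) {τ : ν → Matrix o o ℝ} {J : Matrix o o ℝ} (h : ∀ x, Commute (τ x) J) : Commute (∑ x, q x • τ x) J :=
  Commute.sum_left _ _ _ fun x _ => (h x).smul_left (q x)

/-- **`exists_polarLink_commute` — POLAR LINKS IN THE COMMUTANT** [our proof; PART 58 `exists_polarLink`'s hypotheses + an orthogonal `J` commuting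
with the block transporters and the chain transports]: there are coarse links with PART 53 ∕ 57's three polar letters AND `R′_{e′}J = JR′_{e′}` for all `e′`
(for a complex structure `J`: U(N)-valued data give U(N)-valued polar links). -/
theorem exists_polarLink_commute
    (hq : ∀ y x, 0 ≤ q y x) (hq1 : ∀ y, ∑ x, q y x = 1)
    (hloop : ∀ e' x x', q (src' e') x ≠ 0 → q (src' e') x' ≠ 0 → ∀ w : o → ℝ,
      (((W (src' e') x * T e' x ℓ * (W (tgt' e') (σ e' x))ᵀ)ᵀ * (W (src' e') x' * T e' x' ℓ * (W (tgt' e') (σ e' x'))ᵀ) - 1) *ᵥ w) ⬝ᵥ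
          (((W (src' e') x * T e' x ℓ * (W (tgt' e') (σ e' x))ᵀ)ᵀ * (W (src' e') x' * T e' x' ℓ * (W (tgt' e') (σ e' x'))ᵀ) - 1) *ᵥ w) ≤
        D ^ 2 * (w ⬝ᵥ w))
    (hD0 : 0 ≤ D) (hD1 : D < 1) {J : Matrix o o ℝ} (hJ : Jᵀ * J = 1) (hWJ : ∀ y x, Commute (W y x) J) (hTJ : ∀ e' x, Commute (T e' x ℓ) J) :
    ∃ R' : β' → Matrix o o ℝ, (∀ e', (R' e')ᵀ * R' e' = 1) ∧
      (∀ e', (∑ x, q (src' e') x • (1 - W (src' e') x * T e' x ℓ * (W (tgt' e') (σ e' x))ᵀ * (R' e')ᵀ))ᵀ =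
        ∑ x, q (src' e') x • (1 - W (src' e') x * T e' x ℓ * (W (tgt' e') (σ e' x))ᵀ * (R' e')ᵀ)) ∧
      (∀ e' (w : o → ℝ), 0 ≤ w ⬝ᵥ ((∑ x, q (src' e') x • (W (src' e') x * T e' x ℓ * (W (tgt' e') (σ e' x))ᵀ * (R' e')ᵀ)) *ᵥ w)) ∧
      (∀ e', Commute (R' e') J) := by
  -- the open transports and their means commute with `J`
  have hτJ : ∀ e' x, Commute (W (src' e') x * T e' x ℓ * (W (tgt' e') (σ e' x))ᵀ) J := fun e' x =>
    ((hWJ _ _).mul_left (hTJ e' x)).mul_left (commute_transpose_of_orthogonal hJ (hWJ _ _))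
  have h : ∀ e', ∃ R'e : Matrix o o ℝ, R'eᵀ * R'e = 1 ∧
      ((∑ x, q (src' e') x • (W (src' e') x * T e' x ℓ * (W (tgt' e') (σ e' x))ᵀ)) * R'eᵀ)ᵀ =
        (∑ x, q (src' e') x • (W (src' e') x * T e' x ℓ * (W (tgt' e') (σ e' x))ᵀ)) * R'eᵀ ∧
      (∀ w : o → ℝ, 0 ≤ w ⬝ᵥ (((∑ x, q (src' e') x • (W (src' e') x * T e' x ℓ * (W (tgt' e') (σ e' x))ᵀ)) * R'eᵀ) *ᵥ w)) ∧
      Commute R'e J := fun e' => by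
    obtain ⟨R'e, h1, h2, h3, h4⟩ := exists_orthogonal_polar_commute (mulVec_injective_of_loops (hq (src' e')) (hq1 (src' e'))
      (fun x => W (src' e') x * T e' x ℓ * (W (tgt' e') (σ e' x))ᵀ) hD0 hD1 (hloop e'))
    exact ⟨R'e, h1, h2, h3, h4 J hJ (commute_wsum (q (src' e')) (hτJ e'))⟩
  choose R' hR'o hR's hR'p hR'J using h
  have e3 : ∀ e', ∑ x, q (src' e') x • (W (src' e') x * T e' x ℓ * (W (tgt' e') (σ e' x))ᵀ * (R' e')ᵀ) =
      (∑ x, q (src' e') x • (W (src' e') x * T e' x ℓ * (W (tgt' e') (σ e' x))ᵀ)) * (R' e')ᵀ := fun e' =>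
    (wsum_mul (q (src' e')) (fun x => W (src' e') x * T e' x ℓ * (W (tgt' e') (σ e' x))ᵀ) (R' e')ᵀ).symm
  have e2 : ∀ e', ∑ x, q (src' e') x • (1 - W (src' e') x * T e' x ℓ * (W (tgt' e') (σ e' x))ᵀ * (R' e')ᵀ) =
      1 - (∑ x, q (src' e') x • (W (src' e') x * T e' x ℓ * (W (tgt' e') (σ e' x))ᵀ)) * (R' e')ᵀ := fun e' => by
    rw [← e3 e', Finset.sum_congr rfl fun x _ => smul_sub (q (src' e') x) (1 : Matrix o o ℝ) _, Finset.sum_sub_distrib,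
      ← Finset.sum_smul, hq1, one_smul]
  refine ⟨R', hR'o, fun e' => ?_, fun e' w => ?_, hR'J⟩
  · rw [e2 e', transpose_sub, transpose_one, hR's e']
  · rw [e3 e']; exact hR'p e' w

end Link

end Summit.QuantumFields.BalabanUV.Beta.GAN24.DerivativeRateTransferJensenMassFreePolarCommute

end
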